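import Summits.RiemannHypothesis.RiemannHypothesis.Theorems.OddSectorOddOneSignedWindowsRealPart
import Literature.NumberTheory.LFunctions.WeilEvenGroundState
import HarnessLib

/-!
# Real parts of EVEN-sector Weil ground states
(crux `EvenSectorBarta.EvenOneSignedWindows`, item stmt-RiemannHypothesis-19953; route F8 / hand-off H13 of the rh-explicit HANDOFF track; RH-free)

The even twin of `OddSector.isWeilOddGroundState_rePart` (`OddSectorOddOneSignedWindowsRealPart.lean`): the normalised real part of an
operator-free even-sector ground state `u` (`IsWeilEvenGroundState a u`) is again an even-sector ground state whenever `Re u ≠ 0` in `L²`; so is the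
normalised imaginary part. Use (route F8): the certificate lemma `oneSignedWindow_of_sourceCertificate`
(`EvenSectorBartaEvenOneSignedWindowsSourceCertificate.lean`) wants a REAL-valued even-sector ground state near the certified profile; two-level
proximity (`evenTwoLevelProximity`) delivers a complex one `u` with `⟨v, u⟩ ≥ 0`, and `Re u/‖Re u‖₂` is then real, even, a ground state, and (for
`‖u − v‖₂` small, `v` real) still near `v`. Proof verbatim from the odd file with parities flipped (Weil's distribution is real:
`Re Q(g) = Re Q(Re g) + Re Q(Im g)`, `re_weilQuadratic_eq_rePart_add_imPart`). Nothing here bears on RH.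

References: E. Bombieri, Rend. Mat. Acc. Lincei (9) 11 (2000), §4 Problem 2, Thm 3, §9 Lemma 11 (`Bombieri2000Weil`).
-/

noncomputable section

set_option linter.dupNamespace false

open Complex Filter Set MeasureTheory
open scoped Real Topology ComplexConjugate

namespace Summit.RiemannHypothesis.RiemannHypothesis.Theorems.PolarPerronFrobenius

open Literature.NumberTheory.LFunctions
open Literature.NumberTheory.LFunctions.ConnesVanSuijlekom
open Summit.RiemannHypothesis.RiemannHypothesis.Theorems.OddSector
  (isWeilTest_rePart isWeilTest_imPart tsupport_rePart_subset tsupport_imPart_subset memLp_rePart integral_norm_sq_rePart_add_imPart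
    re_weilQuadratic_eq_rePart_add_imPart norm_rePart_le)

/-- `MemLp f 2` functions have integrable `‖f‖²`. [folklore] -/
private theorem integrable_norm_sq_of_memLp' {f : ℝ → ℂ} (hf : MemLp f 2) : Integrable fun t ↦ ‖f t‖ ^ 2 :=
  (memLp_two_iff_integrable_sq_norm hf.1).1 hf

/-- **The normalised real part of an even-sector ground state is an even-sector ground state.**
If `u` is an even-sector ground state at the window `a` whose real part `Re u` is not `0` in
`L²`, then `Re u/‖Re u‖₂` is an even-sector ground state at `a`. Proof: for the even minimising
sequence `gₙ → u` with real/imaginary parts `eₙ, oₙ` (odd window tests),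
`Re Q(gₙ) = Re Q(eₙ) + Re Q(oₙ)` and `‖eₙ‖² + ‖oₙ‖² = 1`, so
`ε_ev‖eₙ‖² ≤ Re Q(eₙ) ≤ Re Q(gₙ) − ε_ev(1 − ‖eₙ‖²)`; `‖eₙ − Re u‖₂ ≤ ‖gₙ − u‖₂ → 0` gives
`‖eₙ‖² → ‖Re u‖² > 0` and `Re Q(eₙ) → ε_ev‖Re u‖²`, whence `eₙ/‖eₙ‖₂` (eventually defined) is
an `L²`-normalised even minimising sequence converging to `Re u/‖Re u‖₂`.
[cite: Bombieri2000Weil, §4 Problem 2, Thm 3 and §9 Lemma 11] -/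
theorem isWeilEvenGroundState_rePart {a : ℝ} {u : ℝ → ℂ} (hu : IsWeilEvenGroundState a u)
    (hN : 0 < ∫ t, ‖(((u t).re : ℝ) : ℂ)‖ ^ 2) :
    IsWeilEvenGroundState a (fun t ↦
      (((Real.sqrt (∫ s, ‖(((u s).re : ℝ) : ℂ)‖ ^ 2))⁻¹ : ℝ) : ℂ) * (((u t).re : ℝ) : ℂ)) := by
  -- adapted from `isWeilGroundState_evenPart`
  -- (Theorems/WeilGroundStateGroundStatesConvergeToXiEvenWitnessParity.lean), parity ↦ real/imaginary parts
  obtain ⟨hmem, g, hg, hQ, hL⟩ := (isWeilEvenGroundState_iff_tendsto a u).1 hu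
  set N : ℝ := ∫ s, ‖(((u s).re : ℝ) : ℂ)‖ ^ 2 with hNdef
  set ε : ℝ := weilEvenGroundEnergy a with hεdef
  set e : ℕ → ℝ → ℂ := fun n t ↦ (((g n t).re : ℝ) : ℂ) with hedef
  set o : ℕ → ℝ → ℂ := fun n t ↦ (((g n t).im : ℝ) : ℂ) with hodef
  set ue : ℝ → ℂ := fun t ↦ (((u t).re : ℝ) : ℂ) with huedef
  have hgm : ∀ n, MemLp (g n) 2 := fun n ↦
    (hg n).1.1.continuous.memLp_of_hasCompactSupport (hg n).1.2
  have het : ∀ n, IsWeilTest (e n) := fun n ↦ isWeilTest_rePart (hg n).1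
  have hot : ∀ n, IsWeilTest (o n) := fun n ↦ isWeilTest_imPart (hg n).1
  have hes : ∀ n, tsupport (e n) ⊆ Icc (-a) a := fun n ↦
    (tsupport_rePart_subset _).trans (hg n).2.1
  have hos : ∀ n, tsupport (o n) ⊆ Icc (-a) a := fun n ↦
    (tsupport_imPart_subset _).trans (hg n).2.1
  have heo : ∀ n t, e n (-t) = e n t := fun n t ↦ by
    simp only [hedef, (hg n).2.2.1 t]
  have hoo : ∀ n t, o n (-t) = o n t := fun n t ↦ by
    simp only [hodef, (hg n).2.2.1 t]
  have hem : ∀ n, MemLp (e n) 2 := fun n ↦ memLp_rePart (hgm n)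
  have huem : MemLp ue 2 := memLp_rePart hmem
  -- norms and energies split along real/imaginary parts
  set Ne : ℕ → ℝ := fun n ↦ ∫ t, ‖e n t‖ ^ 2 with hNedef
  have hsplit : ∀ n, Ne n + ∫ t, ‖o n t‖ ^ 2 = 1 := fun n ↦ by
    have := integral_norm_sq_rePart_add_imPart (hgm n)
    rw [(hg n).2.2.2] at this
    exact this
  have hQsplit : ∀ n, (weilQuadratic (g n)).re =
      (weilQuadratic (e n)).re + (weilQuadratic (o n)).re := fun n ↦
    re_weilQuadratic_eq_rePart_add_imPart (hg n).1
  have hlow : ∀ n, ε * Ne n ≤ (weilQuadratic (e n)).re := fun n ↦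
    weilEvenGroundEnergy_mul_le_re (het n) (hes n) (heo n)
  have hupp : ∀ n, (weilQuadratic (e n)).re ≤ (weilQuadratic (g n)).re - ε * (1 - Ne n) := by
    intro n
    have h1 := weilEvenGroundEnergy_mul_le_re (hot n) (hos n) (hoo n)
    have h2 := hsplit n
    have h3 := hQsplit n
    have h4 : ∫ t, ‖o n t‖ ^ 2 = 1 - Ne n := by linarith
    rw [h4] at h1
    linarith
  -- `eₙ → Re u` in `L²`
  have hD : Tendsto (fun n ↦ ∫ t, ‖e n t - ue t‖ ^ 2) atTop (𝓝 0) := by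
    refine squeeze_zero (fun n ↦ integral_nonneg fun _ ↦ by positivity) (fun n ↦ ?_) hL
    refine integral_mono (integrable_norm_sq_of_memLp' ((hem n).sub huem))
      (integrable_norm_sq_of_memLp' ((hgm n).sub hmem)) fun t ↦ ?_
    have e1 : e n t - ue t = (((g n t - u t).re : ℝ) : ℂ) := by
      simp only [hedef, huedef, Complex.sub_re, Complex.ofReal_sub]
    dsimp only
    rw [e1]
    exact pow_le_pow_left₀ (norm_nonneg _) (norm_rePart_le _) 2
  -- `‖eₙ‖² → N`
  have hNe : Tendsto Ne atTop (𝓝 N) := by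
    have hsqrt : Tendsto (fun n ↦ Real.sqrt (∫ t, ‖e n t - ue t‖ ^ 2)) atTop (𝓝 0) := by
      simpa using hD.sqrt
    set S : ℝ := Real.sqrt N with hS
    have h1 : ∀ n, Real.sqrt (Ne n) ≤ S + Real.sqrt (∫ t, ‖e n t - ue t‖ ^ 2) := fun n ↦ by
      have := sqrt_integral_norm_sq_sub_le huem (huem.sub (hem n))
      simpa only [Pi.sub_apply, sub_sub_cancel, norm_sub_rev (ue _)] using this
    have h2 : ∀ n, S ≤ Real.sqrt (Ne n) + Real.sqrt (∫ t, ‖e n t - ue t‖ ^ 2) := fun n ↦ by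
      have := sqrt_integral_norm_sq_sub_le (hem n) ((hem n).sub huem)
      simpa only [Pi.sub_apply, sub_sub_cancel] using this
    have h3 : Tendsto (fun n ↦ Real.sqrt (Ne n)) atTop (𝓝 S) := by
      have hup : Tendsto (fun n ↦ S + Real.sqrt (∫ t, ‖e n t - ue t‖ ^ 2)) atTop (𝓝 S) := by
        simpa using tendsto_const_nhds.add hsqrt
      have hlo : Tendsto (fun n ↦ S - Real.sqrt (∫ t, ‖e n t - ue t‖ ^ 2)) atTop (𝓝 S) := by
        simpa using tendsto_const_nhds.sub hsqrt
      exact tendsto_of_tendsto_of_tendsto_of_le_of_le hlo hup (fun n ↦ by linarith [h2 n])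
        (fun n ↦ h1 n)
    have h4 : Tendsto (fun n ↦ Real.sqrt (Ne n) ^ 2) atTop (𝓝 (S ^ 2)) := h3.pow 2
    have h5 : ∀ n, Real.sqrt (Ne n) ^ 2 = Ne n := fun n ↦
      Real.sq_sqrt (integral_nonneg fun _ ↦ by positivity)
    simp only [h5] at h4
    rwa [hS, Real.sq_sqrt hN.le] at h4
  -- `Re Q(eₙ) → ε N`
  have hQe : Tendsto (fun n ↦ (weilQuadratic (e n)).re) atTop (𝓝 (ε * N)) := by
    have hlo : Tendsto (fun n ↦ ε * Ne n) atTop (𝓝 (ε * N)) := tendsto_const_nhds.mul hNe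
    have hup : Tendsto (fun n ↦ (weilQuadratic (g n)).re - ε * (1 - Ne n)) atTop
        (𝓝 (ε * N)) := by
      have h1 : Tendsto (fun n ↦ ε * (1 - Ne n)) atTop (𝓝 (ε * (1 - N))) :=
        tendsto_const_nhds.mul (tendsto_const_nhds.sub hNe)
      have h2 := hQ.sub h1
      convert h2 using 2
      ring
    exact tendsto_of_tendsto_of_tendsto_of_le_of_le hlo hup hlow hupp
  -- eventually `‖eₙ‖² > N/2`
  obtain ⟨n₀, hn₀⟩ := eventually_atTop.1 (hNe.eventually (lt_mem_nhds (by linarith : N / 2 < N)))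
  have hNepos : ∀ n, 0 < Ne (n + n₀) := fun n ↦ by
    have := hn₀ (n + n₀) (Nat.le_add_left _ _)
    linarith
  -- the normalised real parts
  set r : ℕ → ℝ := fun n ↦ (Real.sqrt (Ne (n + n₀)))⁻¹ with hrdef
  set R : ℝ := (Real.sqrt N)⁻¹ with hRdef
  have hrpos : ∀ n, 0 < r n := fun n ↦ inv_pos.2 (Real.sqrt_pos.2 (hNepos n))
  have hr2 : ∀ n, r n ^ 2 = (Ne (n + n₀))⁻¹ := fun n ↦ by
    rw [hrdef]
    dsimp only
    rw [inv_pow, Real.sq_sqrt (hNepos n).le]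
  have hrR : Tendsto r atTop (𝓝 R) :=
    ((hNe.comp (tendsto_add_atTop_nat n₀)).sqrt.inv₀ (Real.sqrt_ne_zero'.2 hN))
  refine IsWeilEvenGroundState.of_tendsto (huem.const_mul _)
    (g := fun n t ↦ ((r n : ℝ) : ℂ) * e (n + n₀) t) (fun n ↦
    ⟨(het _).const_mul _, tsupport_mul_subset_right.trans (hes _), fun t ↦ ?_, ?_⟩) ?_ ?_
  · -- evenness
    rw [heo]
  · -- normalisation
    simp only [norm_mul, mul_pow, Complex.norm_real, Real.norm_of_nonneg (hrpos n).le]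
    rw [integral_const_mul, hr2 n]
    exact inv_mul_cancel₀ (hNepos n).ne'
  · -- energies
    have key : ∀ n, (weilQuadratic (fun t ↦ ((r n : ℝ) : ℂ) * e (n + n₀) t)).re =
        (Ne (n + n₀))⁻¹ * (weilQuadratic (e (n + n₀))).re := fun n ↦ by
      rw [weilQuadratic_const_mul, Complex.normSq_ofReal, Complex.re_ofReal_mul, ← sq, hr2 n]
    have h1 : Tendsto (fun n ↦ (Ne (n + n₀))⁻¹ * (weilQuadratic (e (n + n₀))).re) atTop
        (𝓝 (N⁻¹ * (ε * N))) :=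
      ((hNe.comp (tendsto_add_atTop_nat n₀)).inv₀ hN.ne').mul
        (hQe.comp (tendsto_add_atTop_nat n₀))
    have h2 : N⁻¹ * (ε * N) = ε := by field_simp
    rw [h2] at h1
    exact h1.congr fun n ↦ (key n).symm
  · -- `L²` convergence to `R · Re u`
    have hD' : Tendsto (fun n ↦ ∫ t, ‖e (n + n₀) t - ue t‖ ^ 2) atTop (𝓝 0) :=
      hD.comp (tendsto_add_atTop_nat n₀)
    have hNe' : Tendsto (fun n ↦ Ne (n + n₀)) atTop (𝓝 N) := hNe.comp (tendsto_add_atTop_nat n₀)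
    have hpt : ∀ n t, ‖((r n : ℝ) : ℂ) * e (n + n₀) t - (R : ℂ) * ue t‖ ^ 2 ≤
        2 * (r n - R) ^ 2 * ‖e (n + n₀) t‖ ^ 2 + 2 * R ^ 2 * ‖e (n + n₀) t - ue t‖ ^ 2 := by
      intro n t
      have e1 : ((r n : ℝ) : ℂ) * e (n + n₀) t - (R : ℂ) * ue t =
          ((r n - R : ℝ) : ℂ) * e (n + n₀) t + (R : ℂ) * (e (n + n₀) t - ue t) := by
        push_cast
        ring
      rw [e1]
      have h1 := norm_add_le (((r n - R : ℝ) : ℂ) * e (n + n₀) t) ((R : ℂ) * (e (n + n₀) t - ue t))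
      rw [norm_mul, norm_mul, Complex.norm_real (r n - R), Complex.norm_real R,
        Real.norm_eq_abs (r n - R), Real.norm_eq_abs R] at h1
      have h2 : 0 ≤ |r n - R| * ‖e (n + n₀) t‖ := by positivity
      have h3 : 0 ≤ |R| * ‖e (n + n₀) t - ue t‖ := by positivity
      calc ‖((r n - R : ℝ) : ℂ) * e (n + n₀) t + (R : ℂ) * (e (n + n₀) t - ue t)‖ ^ 2
          ≤ (|r n - R| * ‖e (n + n₀) t‖ + |R| * ‖e (n + n₀) t - ue t‖) ^ 2 :=
            pow_le_pow_left₀ (norm_nonneg _) h1 2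
        _ ≤ 2 * (|r n - R| * ‖e (n + n₀) t‖) ^ 2 + 2 * (|R| * ‖e (n + n₀) t - ue t‖) ^ 2 := by
            nlinarith [sq_nonneg (|r n - R| * ‖e (n + n₀) t‖ - |R| * ‖e (n + n₀) t - ue t‖)]
        _ = 2 * (r n - R) ^ 2 * ‖e (n + n₀) t‖ ^ 2 + 2 * R ^ 2 * ‖e (n + n₀) t - ue t‖ ^ 2 := by
            rw [mul_pow, mul_pow, sq_abs, sq_abs]; ring
    have hbound : ∀ n, ∫ t, ‖((r n : ℝ) : ℂ) * e (n + n₀) t - (R : ℂ) * ue t‖ ^ 2 ≤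
        2 * (r n - R) ^ 2 * Ne (n + n₀) + 2 * R ^ 2 * ∫ t, ‖e (n + n₀) t - ue t‖ ^ 2 := by
      intro n
      have hi1 : Integrable fun t ↦ ‖e (n + n₀) t‖ ^ 2 := integrable_norm_sq_of_memLp' (hem _)
      have hi2 : Integrable fun t ↦ ‖e (n + n₀) t - ue t‖ ^ 2 :=
        integrable_norm_sq_of_memLp' ((hem _).sub huem)
      have hi3 : Integrable fun t ↦
          2 * (r n - R) ^ 2 * ‖e (n + n₀) t‖ ^ 2 + 2 * R ^ 2 * ‖e (n + n₀) t - ue t‖ ^ 2 :=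
        (hi1.const_mul (2 * (r n - R) ^ 2)).add (hi2.const_mul (2 * R ^ 2))
      have := integral_mono_of_nonneg (Eventually.of_forall fun t ↦ by positivity) hi3
        (Eventually.of_forall (hpt n))
      rw [integral_add (hi1.const_mul _) (hi2.const_mul _), integral_const_mul,
        integral_const_mul] at this
      exact this
    have hlim0 : Tendsto (fun n ↦ 2 * (r n - R) ^ 2 * Ne (n + n₀) +
        2 * R ^ 2 * ∫ t, ‖e (n + n₀) t - ue t‖ ^ 2) atTop (𝓝 0) := by
      have h1 : Tendsto (fun n ↦ r n - R) atTop (𝓝 0) := by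
        simpa using hrR.sub_const R
      have h2 : Tendsto (fun n ↦ 2 * (r n - R) ^ 2 * Ne (n + n₀)) atTop (𝓝 (2 * 0 ^ 2 * N)) :=
        (tendsto_const_nhds.mul (h1.pow 2)).mul hNe'
      have h3 : Tendsto (fun n ↦ 2 * R ^ 2 * ∫ t, ‖e (n + n₀) t - ue t‖ ^ 2) atTop
          (𝓝 (2 * R ^ 2 * 0)) :=
        tendsto_const_nhds.mul hD'
      simpa using h2.add h3
    exact squeeze_zero (fun n ↦ integral_nonneg fun _ ↦ by positivity) hbound hlim0

end Summit.RiemannHypothesis.RiemannHypothesis.Theorems.PolarPerronFrobenius
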